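import Summits.ResolutionOfSingularities.ResolutionOfSingularities.Theorems.ConeExit.Negative.Mirror
import HarnessLib

/-!
# `WildCones.ConeExit` (stmt-ResolutionOfSingularities-16883), line `critical-plane`

Stub `stub_nearDirection'` of the lead's skeleton.

"Near points lie on the ridge `P(L)`" (Hironaka 1970, Thm 2; Cossart–Jannsen–Saito 2020,
Thm 3.14, at a `κ`-rational point), in PURE `MvPolynomial` form, as consumed by the lead's
skeleton (`nearDirection_of`, fed by the chart dictionary `stub_faceDictionary`).

Let `G := cone p c`, a homogeneous form of degree `p` over the field `κ` of characteristic `p`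
(`nearDir_cone_isHomogeneous`; nothing else about `cone` is used), `w := Function.update τ i 1`
and `P := G(w + v̂) = aeval (j ↦ if j = i then 1 else C (τ j) + X j) G` (`v̂ᵢ = 0`).  If the
coefficients of `P` vanish at all exponents `B ≠ 0` with `Bᵢ = 0` and `|B| < p`, then
`w ∈ Linv p c`, i.e. `G(X + wS) = G(X) + G(w) S^p` in `MvPolynomial (Option (Fin n)) κ`
(`S = X none`).  The statement for an arbitrary degree-`p` form is `nearDir_of_isHomogeneous`.

Proof.  Put `G̃ := G(X̂ + Xᵢ w) = aeval θ G` (`θ i = X i`, `θ j = X j + w_j X i`), a degree-`p`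
form whose dehomogenisation at `Xᵢ = 1` is `P`.  Dehomogenisation is injective on the
coefficients of a form (`nearDir_coeff_dehom`), so the hypothesis kills every coefficient of `G̃`
at an exponent `E` with `0 < Eᵢ < p`; hence `G̃ = Q₀ + a Xᵢ^p` with `Xᵢ` not occurring in `Q₀`.
Transport this along the two substitutions `ψ : Xᵢ ↦ X'ᵢ + S`, `ψ₀ : Xᵢ ↦ X'ᵢ`, both with
`X_j ↦ X'_j - w_j X'ᵢ` (`j ≠ i`): `ψ G̃ = G(X' + wS)`, `ψ₀ G̃ = G(X')`, `ψ Q₀ = ψ₀ Q₀`, and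
`(X'ᵢ + S)^p = X'ᵢ^p + S^p` (Frobenius), whence `G(X' + wS) = G(X') + a S^p`; evaluating at
`X' = 0, S = 1` identifies `a = G(w)`.

References: Hironaka, *Additive groups associated with points of a projective space* (1970), Thm 2;
Cossart–Jannsen–Saito, LNM 2270 (2020), Thm 3.14.
-/

noncomputable section

-- single-problem summit: the doubled namespace component `ResolutionOfSingularities` is forced
set_option linter.dupNamespace false

open Summit.ResolutionOfSingularities.ResolutionOfSingularities.Theorems.ConeExit.Negative
  (clean bl ord dv tr step ser pd jac cone Linv dL)
open scoped BigOperators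

namespace Summit.ResolutionOfSingularities.ResolutionOfSingularities.Theorems.WildConesConeExit

open MvPolynomial

variable {n : ℕ} {κ : Type} [Field κ]

/-- The tangent cone datum `cone p c` is a homogeneous form of degree `p`. [folklore] -/
theorem nearDir_cone_isHomogeneous (p : ℕ) (c : (Fin n → ℕ) → κ) :
    (cone p c).IsHomogeneous p := by
  unfold cone
  apply IsHomogeneous.sum
  intro A _
  split_ifs with h
  · apply isHomogeneous_monomial
    rw [Finsupp.degree_eq_sum]
    simpa using h
  · exact isHomogeneous_zero _ _ _

/-- Dehomogenising a monomial at `X i = 1` erases the `i`-th exponent. [folklore] -/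
theorem nearDir_dehom_monomial (i : Fin n) (E : Fin n →₀ ℕ) (a : κ) :
    MvPolynomial.aeval (fun j : Fin n => if j = i then (1 : MvPolynomial (Fin n) κ) else X j)
      (monomial E a) = monomial (E.erase i) a := by
  classical
  conv_lhs => rw [← Finsupp.erase_add_single i E]
  rw [monomial_add_single, map_mul, map_pow, aeval_X, if_pos rfl, one_pow, mul_one,
    aeval_monomial, monomial_eq, algebraMap_eq]
  congr 1
  apply Finsupp.prod_congr
  intro j hj
  have hji : j ≠ i := by
    rintro rfl
    simp [Finsupp.support_erase] at hj
  rw [if_neg hji]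

/-- Coefficient extraction under dehomogenisation of a degree-`m` form `Q`: the coefficient of
`X^(E.erase i)` in `Q|_{X i = 1}` is the coefficient of `X^E` in `Q` whenever `|E| = m`
(dehomogenisation is injective on forms). [folklore] -/
theorem nearDir_coeff_dehom {m : ℕ} {Q : MvPolynomial (Fin n) κ} (hQ : Q.IsHomogeneous m)
    (i : Fin n) {E : Fin n →₀ ℕ} (hE : E.degree = m) :
    MvPolynomial.coeff (E.erase i)
      (MvPolynomial.aeval (fun j : Fin n => if j = i then (1 : MvPolynomial (Fin n) κ) else X j) Q)
      = MvPolynomial.coeff E Q := by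
  classical
  conv_lhs => rw [Q.as_sum]
  rw [map_sum, coeff_sum]
  simp_rw [nearDir_dehom_monomial, coeff_monomial]
  rw [Finset.sum_congr rfl (g := fun E' => if E' = E then coeff E' Q else 0)]
  · rw [Finset.sum_ite_eq']
    split_ifs with hmem
    · rfl
    · exact (notMem_support_iff.mp hmem).symm
  · intro E' hE'
    have hdeg : E'.degree = m := by
      have := hQ (mem_support_iff.mp hE')
      rw [← this, Finsupp.degree_eq_weight_one]
      rfl
    by_cases h : E' = E
    · simp [h]
    · rw [if_neg h, if_neg]
      intro h'
      apply h
      have hi : E' i = E i := by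
        have h1 := congrArg Finsupp.degree (Finsupp.erase_add_single i E')
        have h2 := congrArg Finsupp.degree (Finsupp.erase_add_single i E)
        rw [map_add, Finsupp.degree_single, hdeg, h'] at h1
        rw [map_add, Finsupp.degree_single, hE] at h2
        omega
      rw [← Finsupp.erase_add_single i E', ← Finsupp.erase_add_single i E, h', hi]

/-- Two algebra evaluations that agree off the variable `X i` agree on every polynomial in which
`X i` does not occur. [folklore] -/
theorem nearDir_aeval_congr_off {A : Type} [CommRing A] [Algebra κ A]
    {Q : MvPolynomial (Fin n) κ} {i : Fin n}
    (hQ : ∀ d : Fin n →₀ ℕ, d i ≠ 0 → MvPolynomial.coeff d Q = 0) {f g : Fin n → A}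
    (hfg : ∀ j, j ≠ i → f j = g j) : MvPolynomial.aeval f Q = MvPolynomial.aeval g Q := by
  refine hom_congr_vars (f₁ := (aeval f).toRingHom) (f₂ := (aeval g).toRingHom) ?_ ?_ rfl
  · ext r
    simp
  · intro j hj _
    simp only [AlgHom.toRingHom_eq_coe, RingHom.coe_coe, aeval_X]
    apply hfg
    rintro rfl
    obtain ⟨d, hd, hjd⟩ := (mem_vars_iff_mem_support j).mp hj
    exact (mem_support_iff.mp hd) (hQ d (Finsupp.mem_support_iff.mp hjd))

/-- Algebra evaluations at pointwise equal assignments agree. [folklore] -/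
theorem nearDir_aeval_congr_fun {A : Type} [CommSemiring A] [Algebra κ A] {f g : Fin n → A}
    {Q : MvPolynomial (Fin n) κ} (h : ∀ j, f j = g j) :
    MvPolynomial.aeval f Q = MvPolynomial.aeval g Q := by
  obtain rfl : f = g := funext h
  rfl

/-- **Near points lie on the ridge** (Hironaka), pure polynomial form, for an arbitrary degree-`p`
form `G` in characteristic `p`: if the dehomogenised translate `G(w + v̂)` (`v̂ᵢ = 0`, `wᵢ = 1`)
has no terms in degrees `1 … p-1`, then `G(X + wS) = G(X) + G(w) S^p`.
[cite: Hironaka1970AdditiveGroups, Thm 2] -/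
theorem nearDir_of_isHomogeneous (p : ℕ) (hp : p.Prime) [CharP κ p] {G : MvPolynomial (Fin n) κ}
    (hG : G.IsHomogeneous p) (i : Fin n) (τ : Fin n → κ)
    (hcoef : ∀ B : Fin n →₀ ℕ, B i = 0 → B ≠ 0 → Finset.sum Finset.univ (fun j => B j) < p →
      MvPolynomial.coeff B (MvPolynomial.aeval (fun j : Fin n => if j = i then
        (1 : MvPolynomial (Fin n) κ) else MvPolynomial.C (τ j) + MvPolynomial.X j) G) = 0) :
    MvPolynomial.aeval (fun j : Fin n =>
        (MvPolynomial.X (some j) : MvPolynomial (Option (Fin n)) κ)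
          + MvPolynomial.C (Function.update τ i 1 j) * MvPolynomial.X none) G
      = MvPolynomial.rename some G
        + MvPolynomial.C (MvPolynomial.eval (Function.update τ i 1) G)
          * (MvPolynomial.X none) ^ p := by
  classical
  haveI : Fact p.Prime := ⟨hp⟩
  set w : Fin n → κ := Function.update τ i 1
  have hwi : w i = 1 := by simp [w]
  have hwj : ∀ j, j ≠ i → w j = τ j := fun j hj => by simp [w, hj]
  -- (a) the re-homogenised translate `G̃ = G(X̂ + Xᵢ w)`, a form of degree `p`
  set θ : Fin n → MvPolynomial (Fin n) κ :=
    fun j => if j = i then X i else X j + C (w j) * X i with hθ_def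
  set Gt : MvPolynomial (Fin n) κ := aeval θ G with hGt_def
  have hGt : Gt.IsHomogeneous p := by
    have h := hG.aeval θ (n := 1) (fun j => ?_)
    · rw [one_mul] at h
      exact h
    · simp only [hθ_def]
      split_ifs
      · exact isHomogeneous_X _ _
      · exact (isHomogeneous_X _ _).add ((isHomogeneous_X _ _).C_mul _)
  -- (b) dehomogenising `G̃` at `Xᵢ = 1` gives `P = G(w + v̂)`
  have hdehom : aeval (fun j : Fin n => if j = i then (1 : MvPolynomial (Fin n) κ) else X j) Gt
      = aeval (fun j : Fin n => if j = i then (1 : MvPolynomial (Fin n) κ) else C (τ j) + X j)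
          G := by
    rw [hGt_def, comp_aeval_apply]
    apply nearDir_aeval_congr_fun
    intro j
    by_cases hj : j = i
    · subst hj
      simp [hθ_def]
    · simp [hθ_def, hj, hwj j hj]
      ring
  -- (c) KEY: the coefficients of `G̃` at exponents `E ≠ p eᵢ` with `Eᵢ ≠ 0` vanish
  have hkey : ∀ E : Fin n →₀ ℕ, E i ≠ 0 → E ≠ Finsupp.single i p → coeff E Gt = 0 := by
    intro E hEi hEs
    by_cases hdeg : E.degree = p
    · have hsum : (E.erase i).degree + E i = p := by
        have h1 := congrArg Finsupp.degree (Finsupp.erase_add_single i E)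
        rwa [map_add, Finsupp.degree_single, hdeg] at h1
      have hlt : E i < p := by
        refine lt_of_le_of_ne (by omega) (fun h => hEs ?_)
        have h0 : E.erase i = 0 := by
          rw [← Finsupp.degree_eq_zero_iff]; omega
        rw [← Finsupp.erase_add_single i E, h0, zero_add, h]
      rw [← nearDir_coeff_dehom hGt i hdeg, hdehom]
      apply hcoef
      · exact Finsupp.erase_same
      · intro h0
        rw [h0, map_zero] at hsum
        omega
      · rw [← Finsupp.degree_eq_sum]
        omega
    · exact hGt.coeff_eq_zero hdeg
  -- (d) hence `G̃ = Q₀ + a Xᵢ^p` with `Xᵢ` not occurring in `Q₀`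
  set a : κ := coeff (Finsupp.single i p) Gt with ha_def
  set Q₀ : MvPolynomial (Fin n) κ := Gt - C a * X i ^ p with hQ₀_def
  have hQ₀ : ∀ d : Fin n →₀ ℕ, d i ≠ 0 → coeff d Q₀ = 0 := by
    intro d hd
    simp only [hQ₀_def, coeff_sub, C_mul_X_pow_eq_monomial, coeff_monomial]
    split_ifs with h
    · subst h
      simp [ha_def]
    · rw [hkey d hd (fun h' => h h'.symm), sub_zero]
  have hsplit : Gt = Q₀ + C a * X i ^ p := (sub_add_cancel _ _).symm
  -- (e) transport along `ψ` (`Xᵢ ↦ X'ᵢ + S`) and `ψ₀` (`Xᵢ ↦ X'ᵢ`), `X_j ↦ X'_j - w_j X'ᵢ`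
  set ψv : Fin n → MvPolynomial (Option (Fin n)) κ := fun j =>
    if j = i then X (some i) + X none else X (some j) - C (w j) * X (some i) with hψv_def
  set ψ₀v : Fin n → MvPolynomial (Option (Fin n)) κ := fun j =>
    if j = i then X (some i) else X (some j) - C (w j) * X (some i) with hψ₀v_def
  have e1 : aeval ψv Gt = aeval (fun j : Fin n => (X (some j) : MvPolynomial (Option (Fin n)) κ)
      + C (w j) * X none) G := by
    rw [hGt_def, comp_aeval_apply]
    apply nearDir_aeval_congr_fun
    intro j
    by_cases hj : j = i
    · subst hj
      simp [hθ_def, hψv_def, hwi]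
    · simp [hθ_def, hψv_def, hj]
      ring
  have e2 : aeval ψ₀v Gt = rename some G := by
    rw [hGt_def, comp_aeval_apply, rename_eq_aeval]
    apply nearDir_aeval_congr_fun
    intro j
    by_cases hj : j = i
    · subst hj
      simp [hθ_def, hψ₀v_def]
    · simp [hθ_def, hψ₀v_def, hj]
  have e3 : aeval ψv Q₀ = aeval ψ₀v Q₀ :=
    nearDir_aeval_congr_off hQ₀ (fun j hj => by simp [hψv_def, hψ₀v_def, hj])
  have hchar : ((X (some i) : MvPolynomial (Option (Fin n)) κ) + X none) ^ p
      = X (some i) ^ p + X none ^ p := add_pow_char _ _ _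
  have key : aeval (fun j : Fin n => (X (some j) : MvPolynomial (Option (Fin n)) κ)
      + C (w j) * X none) G = rename some G + C a * X none ^ p := by
    rw [← e1, ← e2, hsplit, map_add, map_add, e3, map_mul, map_mul, map_pow, map_pow, aeval_C,
      aeval_C, aeval_X, aeval_X, algebraMap_eq]
    simp only [hψv_def, hψ₀v_def, if_pos rfl, hchar]
    ring
  -- (f) identify `a = G(w)` by evaluating `key` at `X' = 0`, `S = 1`
  have hG0 : constantCoeff G = 0 :=
    hG.coeff_eq_zero (d := 0) (by simpa using hp.ne_zero.symm)
  have ha : a = eval w G := by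
    have h := congrArg (aeval (fun o : Option (Fin n) => o.elim (1 : κ) (fun _ => 0))) key
    rw [comp_aeval_apply, map_add, aeval_rename, map_mul, map_pow, aeval_X, aeval_C] at h
    simp only [map_add, map_mul, aeval_X, aeval_C, Option.elim_none, Option.elim_some,
      Algebra.algebraMap_self_apply, mul_one, zero_add, one_pow, Function.comp_def, aeval_zero',
      hG0] at h
    exact h.symm
  rw [key, ha]

/-- **Stub `stub_nearDirection'`** of the line `critical-plane` (near points lie on `P(L)`,
polynomial form): if the face coefficients of `a_p(w + v̂)` vanish in degrees `1 … p-1`, then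
`w = Function.update τ i 1 ∈ L(a_p) = Linv p c`. [cite: Hironaka1970AdditiveGroups, Thm 2] -/
theorem stub_nearDirection' : ∀ (p : ℕ), p.Prime → ∀ (n : ℕ) (κ : Type) [Field κ] [CharP κ p]
    (c : (Fin n → ℕ) → κ) (i : Fin n) (τ : Fin n → κ), (∀ B : Fin n →₀ ℕ, B i = 0 → B ≠ 0 →
    Finset.sum Finset.univ (fun j => B j) < p → MvPolynomial.coeff B (MvPolynomial.aeval
    (fun j : Fin n => if j = i then (1 : MvPolynomial (Fin n) κ) else MvPolynomial.C (τ j) +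
    MvPolynomial.X j) (cone p c)) = 0) → Function.update τ i 1 ∈ Linv p c := by
  intro p hp n κ _ _ c i τ hcoef
  exact nearDir_of_isHomogeneous p hp (nearDir_cone_isHomogeneous p c) i τ hcoef

end Summit.ResolutionOfSingularities.ResolutionOfSingularities.Theorems.WildConesConeExit

end
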